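import Summits.HubbardSuperconductivity.HubbardSuperconductivity.Theorems.BcsKacWindowInfraredCompletionSoftWindowTailBg

/-!
# Crux `InfraredCompletion` (stmt-HubbardSuperconductivity-1321, route BcsKacWindow), line `birth`:
# the sorry-free REDUCTION of the crux to its two physical stubs (skeleton v3 glue)

This file is the whole deductive content of line `birth` (Kennedy–Lieb–Shastry arithmetic on the
SOFT pair-momentum window), free of `sorry` and of unproved inputs: it proves that the crux
`InfraredCompletion` (the window ⇒ bulk transfer of route BcsKacWindow; its body is INLINED below as
the conclusion of `infraredCompletion_of_floor_of_shapeBg`, so that this module does not import the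
route file and can be imported by the eventual closing module) follows from the STATEMENTS of the
two registered physical stubs of skeleton v3 (`Cruxes/InfraredCompletion/Lines/birth.lean`):

* (A) `stub_softWindowFloor` — a FLOOR `c_A Δ(U)² L² ≤ Σ_{m : |q_m|² ≤ (Δ(U)/t)²} S_ψ(m)` on the soft
  window of every bulk torus `Δ(U)·L ≥ t`, `U < U_A(t)` (amplitude: window-scale order survives as
  coarse-grained pair weight);
* (B2') `stub_goldstoneShapeBg` — the Goldstone shape with background
  `S_ψ(m)·|q_m|·L² ≤ A·S_ψ(0) + B·|q_m|·L²` at every nonzero soft momentum (phase coherence: the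
  Anderson–Bogoliubov singularity relative to the condensate plus a flat incoherent background).

Contents (all `[folklore]`, KLS 1988 sum-rule-minus-infrared-bound bookkeeping; no definitions):

* `softWindowInfraredBound_of_floor_of_shapeBg` (registered sub-goal of the crux item) — floor +
  shape-with-background + flat pin ⇒ the RELATIVE soft-tail bound `tail ≤ η · Σ_window` for every
  `η > 0` on bulk tori (the background `B Δ² L²/t²` is paid by the floor for `t ≥ 2B/(c_A η) + 1`,
  the Goldstone part `2A(Δ/t) S(0)` by `t ≥ 8(A+1)/η`; uses the landed `softWindowTail_of_shapeBg`);
* `bulk_of_softWindow` — floor + relative tail bound ⇒ bulk order `c₁ Δ(U)² ≤ Re⟨ψ,Δ_d†Δ_dψ⟩/L⁴`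
  (`η = 1/2`: `S(0) = Σ_window − tail ≥ c_A Δ² L²/2`, `pairStructureFactor_zero`);
* `infraredCompletion_of_floor_of_shapeBg` — (A) → (B2') → the crux, verbatim body.

`S_ψ(m) = pairStructureFactor dWaveFormFactor L ψ m`, `|q_m|² = momentumNormSq L m`
(`PairFieldMomentum`). Source of the scheme: T. Kennedy, E. H. Lieb, B. S. Shastry, PRL 61 (1988)
2582. Lead c13, 2026-08-17.
-/

noncomputable section

-- the mandated namespace `Summit.<Summit>.<Problem>.Theorems…` repeats `HubbardSuperconductivity`
-- (single-problem summit, D-0017), which the `dupNamespace` linter flags on every declaration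
set_option linter.dupNamespace false

namespace Summit.HubbardSuperconductivity.HubbardSuperconductivity.Theorems.InfraredCompletion

open Literature.MathematicalPhysics.QuantumLattice Literature.Probability.LatticeModels
open scoped Matrix

/-- **Relative soft-tail bound from the floor and the shape with background, one datum**
(registered sub-goal `softWindowInfraredBound_of_floor_of_shapeBg` of stmt-HubbardSuperconductivity-1321;
`sorry`-free). For the datum `(a, b, Δ)`: the conclusion of stub A (floor constants `c_A, s_A`), the
conclusion of stub B2' (shape constants `A, B, t₀, U_R`) and the flat pin (only
`0 < Δ(U) ≤ e^{-κ₁/U²} < 1` is used) give, for every `η > 0`, with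
`s_B := max (max s_A t₀) (max (8(A+1)/η) (2B/(c_A η) + 1))` and `U_B := min U_A(t) U_R`, on every
bulk torus `t ≤ Δ(U)·L` (`t ≥ s_B`) and every normalised sector ground state,
`Σ_{m ≠ 0, |q_m|² ≤ (Δ/t)²} S_ψ(m) ≤ η · Σ_{|q_m|² ≤ (Δ/t)²} S_ψ(m)`: the `t`-window lies in the
`t₀`-window, `softWindowTail_of_shapeBg` with `ε = Δ(U)/t` gives `tail ≤ 2A(Δ/t) S(0) + B Δ² L²/t²`,
the first term is `≤ (2A/t) S(0) ≤ (η/4) Σ_W S`, the second `≤ (B/(c_A t²))·c_A Δ² L² ≤ (η/2) Σ_W S`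
by the floor. Kennedy–Lieb–Shastry, PRL 61 (1988) 2582. [folklore] -/
theorem softWindowInfraredBound_of_floor_of_shapeBg :
    ∀ (a b κ₁ κ₂ : ℝ) (Δ : ℝ → ℝ), 0 < κ₁ →
      (∀ U : ℝ, 0 < U → Real.exp (-(κ₂ / U ^ 2)) ≤ Δ U ∧ Δ U ≤ Real.exp (-(κ₁ / U ^ 2))) →
      (∃ cA sA : ℝ, 0 < cA ∧ ∀ t : ℝ, sA ≤ t → ∃ UA : ℝ, 0 < UA ∧
        ∀ δ ∈ Set.Icc a b, ∀ U ∈ Set.Ioo (0:ℝ) UA, ∀ (L : ℕ) [NeZero L], Even L → t ≤ Δ U * L →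
          ∀ ψ : Fock (Orb (FermionTorus 2 L)), star ψ ⬝ᵥ ψ = 1 →
            IsGroundStateInSector (hubbardTorus 2 L 1 U) (2 * ⌊(1 - δ) * (L : ℝ) ^ 2 / 2⌋₊) 0 ψ →
              cA * Δ U ^ 2 * (L : ℝ) ^ 2 ≤
                ∑ m ∈ Finset.univ.filter
                    (fun m : Fin 2 → ZMod L => momentumNormSq L m ≤ (Δ U / t) ^ 2),
                  pairStructureFactor dWaveFormFactor L ψ m) →
      (∃ A B t₀ UR : ℝ, 0 ≤ A ∧ 0 ≤ B ∧ 0 < t₀ ∧ 0 < UR ∧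
        ∀ δ ∈ Set.Icc a b, ∀ U ∈ Set.Ioo (0:ℝ) UR, ∀ (L : ℕ) [NeZero L], Even L → t₀ ≤ Δ U * L →
          ∀ ψ : Fock (Orb (FermionTorus 2 L)), star ψ ⬝ᵥ ψ = 1 →
            IsGroundStateInSector (hubbardTorus 2 L 1 U) (2 * ⌊(1 - δ) * (L : ℝ) ^ 2 / 2⌋₊) 0 ψ →
              ∀ m : Fin 2 → ZMod L, m ≠ 0 → momentumNormSq L m ≤ (Δ U / t₀) ^ 2 →
                pairStructureFactor dWaveFormFactor L ψ m * Real.sqrt (momentumNormSq L m) *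
                    (L : ℝ) ^ 2 ≤
                  A * pairStructureFactor dWaveFormFactor L ψ 0 +
                    B * Real.sqrt (momentumNormSq L m) * (L : ℝ) ^ 2) →
      ∀ η : ℝ, 0 < η → ∃ sB : ℝ, ∀ t : ℝ, sB ≤ t → ∃ UB : ℝ, 0 < UB ∧
        ∀ δ ∈ Set.Icc a b, ∀ U ∈ Set.Ioo (0:ℝ) UB, ∀ (L : ℕ) [NeZero L], Even L → t ≤ Δ U * L →
          ∀ ψ : Fock (Orb (FermionTorus 2 L)), star ψ ⬝ᵥ ψ = 1 →
            IsGroundStateInSector (hubbardTorus 2 L 1 U) (2 * ⌊(1 - δ) * (L : ℝ) ^ 2 / 2⌋₊) 0 ψ →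
              ∑ m ∈ Finset.univ.filter
                  (fun m : Fin 2 → ZMod L => m ≠ 0 ∧ momentumNormSq L m ≤ (Δ U / t) ^ 2),
                pairStructureFactor dWaveFormFactor L ψ m ≤
              η * ∑ m ∈ Finset.univ.filter
                  (fun m : Fin 2 → ZMod L => momentumNormSq L m ≤ (Δ U / t) ^ 2),
                pairStructureFactor dWaveFormFactor L ψ m := by
  intro a b κ₁ κ₂ Δ hκ₁ hpin hfloor hshape
  obtain ⟨cA, sA, hcA, hfl⟩ := hfloor
  obtain ⟨A, B, t₀, UR, hA, hB, ht₀, hUR, hsh⟩ := hshape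
  intro η hη
  refine ⟨max (max sA t₀) (max (8 * (A + 1) / η) (2 * B / (cA * η) + 1)), fun t ht => ?_⟩
  have hsAt : sA ≤ t := le_trans (le_trans (le_max_left _ _) (le_max_left _ _)) ht
  have ht₀t : t₀ ≤ t := le_trans (le_trans (le_max_right _ _) (le_max_left _ _)) ht
  have hηt : 8 * (A + 1) / η ≤ t := le_trans (le_trans (le_max_left _ _) (le_max_right _ _)) ht
  have hBt : 2 * B / (cA * η) + 1 ≤ t :=
    le_trans (le_trans (le_max_right _ _) (le_max_right _ _)) ht
  have htpos : 0 < t := lt_of_lt_of_le ht₀ ht₀t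
  have hBt' : 2 * B / (cA * η) ≤ t := by linarith
  have ht1 : 1 ≤ t := by
    have : 0 ≤ 2 * B / (cA * η) := by positivity
    linarith
  obtain ⟨UA, hUA, hflt⟩ := hfl t hsAt
  refine ⟨min UA UR, lt_min hUA hUR, ?_⟩
  intro δ hδ U hU L _ hL htL ψ hψ hGS
  have hUA' : U ∈ Set.Ioo (0:ℝ) UA := ⟨hU.1, lt_of_lt_of_le hU.2 (min_le_left _ _)⟩
  have hUR' : U ∈ Set.Ioo (0:ℝ) UR := ⟨hU.1, lt_of_lt_of_le hU.2 (min_le_right _ _)⟩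
  have hΔpos : 0 < Δ U := lt_of_lt_of_le (Real.exp_pos _) (hpin U hU.1).1
  have hΔle : Δ U ≤ 1 := by
    refine le_trans (hpin U hU.1).2 (le_of_lt (Real.exp_lt_one_iff.2 ?_))
    have : 0 < κ₁ / U ^ 2 := div_pos hκ₁ (pow_pos hU.1 2)
    linarith
  have hε : 0 < Δ U / t := div_pos hΔpos htpos
  -- the `t`-window lies inside the `t₀`-window
  have hwin : ∀ m : Fin 2 → ZMod L, momentumNormSq L m ≤ (Δ U / t) ^ 2 →
      momentumNormSq L m ≤ (Δ U / t₀) ^ 2 := by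
    intro m hm
    refine le_trans hm (pow_le_pow_left₀ hε.le ?_ 2)
    exact div_le_div_of_nonneg_left hΔpos.le ht₀ ht₀t
  have hbulk₀ : t₀ ≤ Δ U * L := le_trans ht₀t htL
  -- the arithmetic: tail ≤ 2A(Δ/t) S(0) + B (Δ/t)² L²
  have htail := softWindowTail_of_shapeBg L ψ A B (Δ U / t) hA hB hε
    (fun m hm0 hm => hsh δ hδ U hUR' L hL hbulk₀ ψ hψ hGS m hm0 (hwin m hm))
  -- the floor at `t`
  have hflo := hflt δ hδ U hUA' L hL htL ψ hψ hGS
  -- notation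
  set S0 : ℝ := pairStructureFactor dWaveFormFactor L ψ 0 with hS0def
  set W : ℝ := ∑ m ∈ Finset.univ.filter
      (fun m : Fin 2 → ZMod L => momentumNormSq L m ≤ (Δ U / t) ^ 2),
    pairStructureFactor dWaveFormFactor L ψ m with hWdef
  have hS0 : 0 ≤ S0 := pairStructureFactor_nonneg _ _ _ _
  have h0W : (0 : Fin 2 → ZMod L) ∈
      Finset.univ.filter (fun m : Fin 2 → ZMod L => momentumNormSq L m ≤ (Δ U / t) ^ 2) := by
    rw [Finset.mem_filter, momentumNormSq_zero]
    exact ⟨Finset.mem_univ _, sq_nonneg _⟩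
  have hS0W : S0 ≤ W :=
    Finset.single_le_sum (f := fun m => pairStructureFactor dWaveFormFactor L ψ m)
      (fun m _ => pairStructureFactor_nonneg _ _ _ _) h0W
  have hW0 : 0 ≤ W := le_trans hS0 hS0W
  -- first term: `2A(Δ/t) S0 ≤ (η/4) W`
  have h1 : 2 * A * (Δ U / t) * S0 ≤ η / 4 * W := by
    have h1a : 2 * A * (Δ U / t) ≤ 2 * A / t := by
      rw [← mul_div_assoc]
      exact div_le_div_of_nonneg_right (by nlinarith) htpos.le
    have h1b : 2 * A / t ≤ η / 4 := by
      rw [div_le_iff₀ htpos]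
      have h := (div_le_iff₀ hη).1 hηt
      nlinarith
    calc 2 * A * (Δ U / t) * S0 ≤ η / 4 * S0 :=
          mul_le_mul_of_nonneg_right (le_trans h1a h1b) hS0
      _ ≤ η / 4 * W := mul_le_mul_of_nonneg_left hS0W (by positivity)
  -- second term: `B (Δ/t)² L² ≤ (B/(c_A t²)) · c_A Δ² L² ≤ (η/2) W`
  have h2 : B * (Δ U / t) ^ 2 * (L : ℝ) ^ 2 ≤ η / 2 * W := by
    have h2a : B * (Δ U / t) ^ 2 * (L : ℝ) ^ 2 =
        B / (cA * t ^ 2) * (cA * Δ U ^ 2 * (L : ℝ) ^ 2) := by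
      field_simp
    have h2b : B / (cA * t ^ 2) ≤ η / 2 := by
      rw [div_le_iff₀ (by positivity)]
      have h := (div_le_iff₀ (by positivity : (0 : ℝ) < cA * η)).1 hBt'
      have htt : t ≤ t ^ 2 := by nlinarith
      have : cA * η * t ≤ cA * η * t ^ 2 := mul_le_mul_of_nonneg_left htt (by positivity)
      nlinarith
    calc B * (Δ U / t) ^ 2 * (L : ℝ) ^ 2
        = B / (cA * t ^ 2) * (cA * Δ U ^ 2 * (L : ℝ) ^ 2) := h2a
      _ ≤ B / (cA * t ^ 2) * W := mul_le_mul_of_nonneg_left hflo (by positivity)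
      _ ≤ η / 2 * W := mul_le_mul_of_nonneg_right h2b hW0
  calc ∑ m ∈ Finset.univ.filter
          (fun m : Fin 2 → ZMod L => m ≠ 0 ∧ momentumNormSq L m ≤ (Δ U / t) ^ 2),
          pairStructureFactor dWaveFormFactor L ψ m
      ≤ 2 * A * (Δ U / t) * S0 + B * (Δ U / t) ^ 2 * (L : ℝ) ^ 2 := htail
    _ ≤ η / 4 * W + η / 2 * W := add_le_add h1 h2
    _ ≤ η * W := by nlinarith [hW0, hη]

/-- **KLS arithmetic on the corner, one datum** (`sorry`-free): a soft-window FLOOR (stub A's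
conclusion for the datum `(a, b, Δ)`) and a RELATIVE soft-tail INFRARED BOUND give the crux's
consequent for that datum. With `η = 1/2`, `t = max s_A s_B`, `U₁ = min U_A U_B`: `0 ∈ W_t`, so
`Σ_{W_t} S = S(0) + tail`, `tail ≤ Σ_{W_t} S / 2`, hence `S(0) ≥ c_A Δ² L² / 2`; and
`S(0) = Re⟨ψ, Δ_d† Δ_d ψ⟩ / L²` (`pairStructureFactor_zero`), so `c₁ = c_A / 2`, `s₁ = t`. This is
the registrar's glue of `Lines/birth.lean`, byte-identical in statement and proof.
Kennedy–Lieb–Shastry, PRL 61 (1988) 2582 (sum rule minus infrared bound). [folklore] -/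
theorem bulk_of_softWindow (a b : ℝ) (Δ : ℝ → ℝ)
    (hfloor : ∃ cA sA : ℝ, 0 < cA ∧ ∀ t : ℝ, sA ≤ t → ∃ UA : ℝ, 0 < UA ∧
        ∀ δ ∈ Set.Icc a b, ∀ U ∈ Set.Ioo (0:ℝ) UA, ∀ (L : ℕ) [NeZero L], Even L → t ≤ Δ U * L →
          ∀ ψ : Fock (Orb (FermionTorus 2 L)), star ψ ⬝ᵥ ψ = 1 →
            IsGroundStateInSector (hubbardTorus 2 L 1 U) (2 * ⌊(1 - δ) * (L : ℝ) ^ 2 / 2⌋₊) 0 ψ →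
              cA * Δ U ^ 2 * (L : ℝ) ^ 2 ≤
                ∑ m ∈ Finset.univ.filter
                    (fun m : Fin 2 → ZMod L => momentumNormSq L m ≤ (Δ U / t) ^ 2),
                  pairStructureFactor dWaveFormFactor L ψ m)
    (htail : ∀ η : ℝ, 0 < η → ∃ sB : ℝ, ∀ t : ℝ, sB ≤ t → ∃ UB : ℝ, 0 < UB ∧
        ∀ δ ∈ Set.Icc a b, ∀ U ∈ Set.Ioo (0:ℝ) UB, ∀ (L : ℕ) [NeZero L], Even L → t ≤ Δ U * L →
          ∀ ψ : Fock (Orb (FermionTorus 2 L)), star ψ ⬝ᵥ ψ = 1 →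
            IsGroundStateInSector (hubbardTorus 2 L 1 U) (2 * ⌊(1 - δ) * (L : ℝ) ^ 2 / 2⌋₊) 0 ψ →
              ∑ m ∈ Finset.univ.filter
                  (fun m : Fin 2 → ZMod L => m ≠ 0 ∧ momentumNormSq L m ≤ (Δ U / t) ^ 2),
                pairStructureFactor dWaveFormFactor L ψ m ≤
              η * ∑ m ∈ Finset.univ.filter
                  (fun m : Fin 2 → ZMod L => momentumNormSq L m ≤ (Δ U / t) ^ 2),
                pairStructureFactor dWaveFormFactor L ψ m) :
    ∃ c₁ s₁ U₁ : ℝ, 0 < c₁ ∧ 0 < U₁ ∧ ∀ δ ∈ Set.Icc a b, ∀ U ∈ Set.Ioo (0:ℝ) U₁,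
      ∀ (L : ℕ) [NeZero L], Even L → s₁ ≤ Δ U * L →
        ∀ ψ : Fock (Orb (FermionTorus 2 L)), star ψ ⬝ᵥ ψ = 1 →
          IsGroundStateInSector (hubbardTorus 2 L 1 U) (2 * ⌊(1 - δ) * (L : ℝ) ^ 2 / 2⌋₊) 0 ψ →
            c₁ * Δ U ^ 2 ≤ (expect ((pairField dWaveFormFactor L)ᴴ * pairField dWaveFormFactor L)
              ψ).re / (L : ℝ) ^ 4 := by
  obtain ⟨cA, sA, hcA, hA'⟩ := hfloor
  obtain ⟨sB, hB'⟩ := htail (1 / 2) one_half_pos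
  set t : ℝ := max sA sB with ht
  obtain ⟨UA, hUA, hA''⟩ := hA' t (le_max_left _ _)
  obtain ⟨UB, hUB, hB''⟩ := hB' t (le_max_right _ _)
  refine ⟨cA / 2, t, min UA UB, half_pos hcA, lt_min hUA hUB, ?_⟩
  intro δ hδ U hU L _ hL htL ψ hψ hGS
  have hUA' : U ∈ Set.Ioo (0:ℝ) UA := ⟨hU.1, lt_of_lt_of_le hU.2 (min_le_left _ _)⟩
  have hUB' : U ∈ Set.Ioo (0:ℝ) UB := ⟨hU.1, lt_of_lt_of_le hU.2 (min_le_right _ _)⟩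
  have hfl := hA'' δ hδ U hUA' L hL htL ψ hψ hGS
  have htl := hB'' δ hδ U hUB' L hL htL ψ hψ hGS
  -- notation: the structure factor, the soft window and its tail
  set S : (Fin 2 → ZMod L) → ℝ := fun m => pairStructureFactor dWaveFormFactor L ψ m with hS
  set W : Finset (Fin 2 → ZMod L) :=
    Finset.univ.filter (fun m : Fin 2 → ZMod L => momentumNormSq L m ≤ (Δ U / t) ^ 2) with hWdef
  set T : Finset (Fin 2 → ZMod L) :=
    Finset.univ.filter (fun m : Fin 2 → ZMod L => m ≠ 0 ∧ momentumNormSq L m ≤ (Δ U / t) ^ 2)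
    with hTdef
  have h0W : (0 : Fin 2 → ZMod L) ∈ W := by
    rw [hWdef, Finset.mem_filter]
    exact ⟨Finset.mem_univ _, by rw [momentumNormSq_zero]; positivity⟩
  -- split the window sum into its zero mode and the tail
  have hsplit : ∑ m ∈ W, S m = S 0 + ∑ m ∈ T, S m := by
    rw [← Finset.add_sum_erase W S h0W]
    congr 1
    apply Finset.sum_congr _ (fun _ _ => rfl)
    ext m
    simp only [hWdef, hTdef, Finset.mem_erase, Finset.mem_filter, Finset.mem_univ, true_and]
  have hfl' : cA * Δ U ^ 2 * (L : ℝ) ^ 2 ≤ ∑ m ∈ W, S m := hfl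
  have htl' : ∑ m ∈ T, S m ≤ 1 / 2 * ∑ m ∈ W, S m := htl
  have hS0 : cA / 2 * Δ U ^ 2 * (L : ℝ) ^ 2 ≤ S 0 := by nlinarith [hsplit, hfl', htl']
  -- `S 0 = Re⟨ψ, Δ_d† Δ_d ψ⟩ / L²`
  have hL0 : (0 : ℝ) < (L : ℝ) := Nat.cast_pos.2 (Nat.pos_of_ne_zero (NeZero.ne L))
  have hL2 : (0 : ℝ) < (L : ℝ) ^ 2 := by positivity
  have hzero : S 0 = (expect ((pairField dWaveFormFactor L)ᴴ * pairField dWaveFormFactor L) ψ).re /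
      (L : ℝ) ^ 2 := by
    rw [hS]
    exact pairStructureFactor_zero dWaveFormFactor L ψ
  rw [hzero, le_div_iff₀ hL2] at hS0
  rw [le_div_iff₀ (by positivity : (0 : ℝ) < (L : ℝ) ^ 4)]
  nlinarith [hS0]

/-- **The reduction of the crux to its two physical stubs** (`sorry`-free, no unproved input): the
statement of stub A (soft-window floor) → the statement of stub B2' (Goldstone shape with
background) → the body of `Summit.HubbardSuperconductivity.HubbardSuperconductivity.Theses.
BcsKacWindow.InfraredCompletion`, verbatim (inlined so that this module need not import the route
file). For each datum: stub A gives the floor, `softWindowInfraredBound_of_floor_of_shapeBg` turns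
floor + shape into the relative tail bound, `bulk_of_softWindow` concludes.
Kennedy–Lieb–Shastry, PRL 61 (1988) 2582. [folklore] -/
theorem infraredCompletion_of_floor_of_shapeBg
    (hA : ∀ (a b κ₁ κ₂ c₀ s₀ : ℝ) (Δ : ℝ → ℝ), 0 < a → a < b → b < 1 / 2 → 0 < κ₁ → κ₁ ≤ κ₂ →
      0 < c₀ → 0 < s₀ →
      (∀ U : ℝ, 0 < U → Real.exp (-(κ₂ / U ^ 2)) ≤ Δ U ∧ Δ U ≤ Real.exp (-(κ₁ / U ^ 2))) →
      (∀ s : ℝ, s₀ ≤ s → ∃ U₁ : ℝ, 0 < U₁ ∧ ∀ δ ∈ Set.Icc a b, ∀ U ∈ Set.Ioo (0:ℝ) U₁,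
        ∀ (L : ℕ) [NeZero L], Even L → s₀ ≤ Δ U * L → Δ U * L ≤ s →
          ∀ ψ : Fock (Orb (FermionTorus 2 L)), star ψ ⬝ᵥ ψ = 1 →
            IsGroundStateInSector (hubbardTorus 2 L 1 U) (2 * ⌊(1 - δ) * (L : ℝ) ^ 2 / 2⌋₊) 0 ψ →
              c₀ * Δ U ^ 2 ≤ (expect ((pairField dWaveFormFactor L)ᴴ * pairField dWaveFormFactor L)
                ψ).re / (L : ℝ) ^ 4) →
      ∃ cA sA : ℝ, 0 < cA ∧ ∀ t : ℝ, sA ≤ t → ∃ UA : ℝ, 0 < UA ∧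
        ∀ δ ∈ Set.Icc a b, ∀ U ∈ Set.Ioo (0:ℝ) UA, ∀ (L : ℕ) [NeZero L], Even L → t ≤ Δ U * L →
          ∀ ψ : Fock (Orb (FermionTorus 2 L)), star ψ ⬝ᵥ ψ = 1 →
            IsGroundStateInSector (hubbardTorus 2 L 1 U) (2 * ⌊(1 - δ) * (L : ℝ) ^ 2 / 2⌋₊) 0 ψ →
              cA * Δ U ^ 2 * (L : ℝ) ^ 2 ≤
                ∑ m ∈ Finset.univ.filter
                    (fun m : Fin 2 → ZMod L => momentumNormSq L m ≤ (Δ U / t) ^ 2),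
                  pairStructureFactor dWaveFormFactor L ψ m)
    (hB : ∀ (a b κ₁ κ₂ c₀ s₀ : ℝ) (Δ : ℝ → ℝ), 0 < a → a < b → b < 1 / 2 → 0 < κ₁ → κ₁ ≤ κ₂ →
      0 < c₀ → 0 < s₀ →
      (∀ U : ℝ, 0 < U → Real.exp (-(κ₂ / U ^ 2)) ≤ Δ U ∧ Δ U ≤ Real.exp (-(κ₁ / U ^ 2))) →
      (∀ s : ℝ, s₀ ≤ s → ∃ U₁ : ℝ, 0 < U₁ ∧ ∀ δ ∈ Set.Icc a b, ∀ U ∈ Set.Ioo (0:ℝ) U₁,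
        ∀ (L : ℕ) [NeZero L], Even L → s₀ ≤ Δ U * L → Δ U * L ≤ s →
          ∀ ψ : Fock (Orb (FermionTorus 2 L)), star ψ ⬝ᵥ ψ = 1 →
            IsGroundStateInSector (hubbardTorus 2 L 1 U) (2 * ⌊(1 - δ) * (L : ℝ) ^ 2 / 2⌋₊) 0 ψ →
              c₀ * Δ U ^ 2 ≤ (expect ((pairField dWaveFormFactor L)ᴴ * pairField dWaveFormFactor L)
                ψ).re / (L : ℝ) ^ 4) →
      ∃ A B t₀ UR : ℝ, 0 ≤ A ∧ 0 ≤ B ∧ 0 < t₀ ∧ 0 < UR ∧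
        ∀ δ ∈ Set.Icc a b, ∀ U ∈ Set.Ioo (0:ℝ) UR, ∀ (L : ℕ) [NeZero L], Even L → t₀ ≤ Δ U * L →
          ∀ ψ : Fock (Orb (FermionTorus 2 L)), star ψ ⬝ᵥ ψ = 1 →
            IsGroundStateInSector (hubbardTorus 2 L 1 U) (2 * ⌊(1 - δ) * (L : ℝ) ^ 2 / 2⌋₊) 0 ψ →
              ∀ m : Fin 2 → ZMod L, m ≠ 0 → momentumNormSq L m ≤ (Δ U / t₀) ^ 2 →
                pairStructureFactor dWaveFormFactor L ψ m * Real.sqrt (momentumNormSq L m) *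
                    (L : ℝ) ^ 2 ≤
                  A * pairStructureFactor dWaveFormFactor L ψ 0 +
                    B * Real.sqrt (momentumNormSq L m) * (L : ℝ) ^ 2) :
    ∀ (a b κ₁ κ₂ c₀ s₀ : ℝ) (Δ : ℝ → ℝ), 0 < a → a < b → b < 1 / 2 → 0 < κ₁ → κ₁ ≤ κ₂ → 0 < c₀ →
      0 < s₀ → (∀ U : ℝ, 0 < U → Real.exp (-(κ₂ / U ^ 2)) ≤ Δ U ∧ Δ U ≤ Real.exp (-(κ₁ / U ^ 2))) →
      (∀ s : ℝ, s₀ ≤ s → ∃ U₁ : ℝ, 0 < U₁ ∧ ∀ δ ∈ Set.Icc a b, ∀ U ∈ Set.Ioo (0:ℝ) U₁,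
        ∀ (L : ℕ) [NeZero L], Even L → s₀ ≤ Δ U * L → Δ U * L ≤ s →
          ∀ ψ : Fock (Orb (FermionTorus 2 L)), star ψ ⬝ᵥ ψ = 1 →
            IsGroundStateInSector (hubbardTorus 2 L 1 U) (2 * ⌊(1 - δ) * (L : ℝ) ^ 2 / 2⌋₊) 0 ψ →
              c₀ * Δ U ^ 2 ≤ (expect ((pairField dWaveFormFactor L)ᴴ * pairField dWaveFormFactor L)
                ψ).re / (L : ℝ) ^ 4) →
      ∃ c₁ s₁ U₁ : ℝ, 0 < c₁ ∧ 0 < U₁ ∧ ∀ δ ∈ Set.Icc a b, ∀ U ∈ Set.Ioo (0:ℝ) U₁,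
        ∀ (L : ℕ) [NeZero L], Even L → s₁ ≤ Δ U * L →
          ∀ ψ : Fock (Orb (FermionTorus 2 L)), star ψ ⬝ᵥ ψ = 1 →
            IsGroundStateInSector (hubbardTorus 2 L 1 U) (2 * ⌊(1 - δ) * (L : ℝ) ^ 2 / 2⌋₊) 0 ψ →
              c₁ * Δ U ^ 2 ≤ (expect ((pairField dWaveFormFactor L)ᴴ * pairField dWaveFormFactor L)
                ψ).re / (L : ℝ) ^ 4 := by
  intro a b κ₁ κ₂ c₀ s₀ Δ ha hab hb hκ₁ hκ₁₂ hc₀ hs₀ hpin hW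
  have hfl := hA a b κ₁ κ₂ c₀ s₀ Δ ha hab hb hκ₁ hκ₁₂ hc₀ hs₀ hpin hW
  exact bulk_of_softWindow a b Δ hfl
    (softWindowInfraredBound_of_floor_of_shapeBg a b κ₁ κ₂ Δ hκ₁ hpin hfl
      (hB a b κ₁ κ₂ c₀ s₀ Δ ha hab hb hκ₁ hκ₁₂ hc₀ hs₀ hpin hW))

end Summit.HubbardSuperconductivity.HubbardSuperconductivity.Theorems.InfraredCompletion

end
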